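/-
Copyright (c) 2026 the pub-hodgecm-mathlib formalisation cell (harness21).  Prover seat hodgecm-mathlib-LH4-p13 (g0): Track A «(D-RAM) FOUR-FRAME» squad of crux H413
(dealer LH4-plan (g10) WORD #29 «p13 → (e) `stub_U2H_typeTwoRow_wild`, HOME-only»; LH4-p06 (g0) U2H ED. 4 design (e₀)), 2026-09-03.
-/
import Summits.HodgeConjecture.HodgeConjecture.Theorems.F0P3cDyRamHFamilySmooth            -- ★ p854867 (LH4-p05 (g0)): brings DEFS LEAF №5 `hFamily = ![hProfileZero, hProfileSharp]`, ★ `exists_vertexCover_of_ramified_wild`, ★ `cmLocalIntegralLevel_one_eq_top_of_smul_eq`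
import Literature.NumberTheory.Rogawski1990.DepthZeroTransferHValuesTypeTwoRamified          -- ★ (A-p12 (g23)): the PLACE-GENERIC type-(2) unfolding `Φ^st(γ_H, 1_{C × U₁}) = ν_H(C × U₁)·#Fix_{γ₂}(U₂ ⧸ C)` and its `χ♯` column
import HarnessLib

/-!
# Crux `H413`, line LH4 «(D-RAM) FOUR-FRAME», unit U2H (ii-H), child (e) `stub_U2H_typeTwoRow_wild` — the H-SIDE TYPE-(2) UNFOLDING of the explicit family `hFamily`
# at ANY ramified non-split place: `Φ^st(γ_H, hFamily s) = ν_H(C_s × U₁) · #Fix_{γ₂}(U₂ ⧸ C_s)`, `C₀ = K₂`, `C₁ = K♯`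

Cell `hodgecm-mathlib` (D-0151), FLOOR 0, crux item H413 = `stmt-HodgeConjecture-24833`, route of record `HCCMUnconditional`; squad F0∕P3c∕LH4, Track A; dealer LH4-plan
(g10) WORD #29; tier-1 module ★ `Cruxes/H413/Lines/F0_P3c_DyRamFourFrame_U2H_HSide.lean`, ROW (2) (type-(2) population) of `stub_U2H_hSideAnchorRows_unit0`'s split — LH4-p06's
ED. 4 design cuts the child (e) as (e₀) H-side values ∧ (e₁) G-side values ∧ (e₂) the shared-coefficient law.  THIS FILE is the law-free, `t`-free half of (e₀): it reduces the
H-side values of the two profiles on the TYPE-(2) population to FIXED-POINT COUNTS in the `U(Φ₂)` tree.  THEOREMS ONLY (no `def`, no instance, no notation, no `sorry`);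
lane `--supports stmt-HodgeConjecture-24833 --as helper`.  Nothing here is the census law: the counts `#Fix_{γ₂}(U₂ ⧸ K₂)`, `#Fix_{γ₂}(U₂ ⧸ K♯)` as functions of the depth
of `γ₂` at a WILD place are the (ii-H) type-(2) law debt (the tame dictionary ★ `sub_one_mul_natCard_fixedBy_add_two_eq_of_*_elliptic` binds a skew UNIFORMISER and the tame
descent of the eigen-discriminant, neither available at a wild `d`-even place).

THE MATHEMATICS ([Rogawski1990] §4.9; [Kottwitz1988] §2; [LabesseLanglands1979] §2).  `H_v = U(Φ₂)(L⁺_v) × U(Φ₁)(L⁺_v)`; a `G`-regular `γ_H = (γ₂, γ₁)` is of TYPE (2) when the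
characteristic polynomial of `γ₂` read at `w` has no root in `L_w` (its eigen-field is a quadratic extension of `L_w`).  Then the stable class of `γ_H` is ONE `H_v`-class and
`Z_{H_v}(γ_H)` is compact, so for every compact open subgroup `C ≤ U(Φ₂)(L⁺_v)` and the canonical orbital measures `mH` (normalised against a Haar measure `ν_H`):
`Φ^st(γ_H, 1_{C × U₁}) = ν_H(C × U₁) · #Fix_{γ₂}(U₂ ⧸ C)` — ★ `stableOrbitalIntegralRel_indicator_prod_top_eq_mul_natCard_fixedBy_of_not_exists_isRoot`, whose binders carry NO
tameness (no `|2|_w = 1`, no `σ_w ϖ = −ϖ`).  The two profiles of ★ `hFamily L w hw ϖ = ![1_{K_H}, 1_{K♯ × U₁}]` ARE such indicators: `K_H = K₂ × K₁` with `K₁ = U(Φ₁)(L⁺_v)`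
(★ `cmLocalIntegralLevel_one_eq_top_of_smul_eq`: the rank-one group is its own integral level at a non-split place), and the set-builder of `hProfileSharp` is `K♯ × U₁` with
`K♯ = ψ⁻¹(U ∩ D_ϖ GL₂(𝒪_w) D_ϖ⁻¹)` the stabiliser of the `ϖ`-modular vertex, compact open at ANY ramified place (★ `exists_vertexCover_of_ramified_wild`) — the set identity is the
`χ♯` column ★ `stableOrbitalIntegralRel_indicator_sharp_eq_mul_natCard_fixedBy_of_not_exists_isRoot`.

* §1 `hProfileZero_eq_indicator_prod_top` (`1_{K_H} = 1_{K₂ × ⊤}`), `hFamily_zero`, `hFamily_one` (the `Fin 2` bookkeeping of ★ №5).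
* §2 **`stableOrbitalIntegralRel_hFamily_zero_typeTwo`** (`s = 0`: `= ν_H(K₂ × U₁) · #Fix_{γ₂}(U₂ ⧸ K₂)`), **`exists_stableOrbitalIntegralRel_hFamily_one_typeTwo`** (`s = 1`: `K♯`
  ∃-packaged WITH its membership criterion, openness and compactness, `= ν_H(K♯ × U₁) · #Fix_{γ₂}(U₂ ⧸ K♯)`).

HONEST LABEL.  Count-neutral helper (`--supports 24833`); (e) stays an unregistered, κ-gated child until U2H ED. 3∕4 and the RC-1 re-cut land — this file freezes no stub
text and asserts no law.  (D-RAM) verdict of record PRINT [LanglandsShelstad1989 Thm. p. 484 ∕ Rogawski1990 Prop. 4.9.1 (a)] ∕ XL; `HC_CM` is proved only modulo the 7 printed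
citations (2 remaining: hLiu418 = `stmt-HodgeConjecture-24832`, h413 = `stmt-HodgeConjecture-24833`) until rung 0 closes.

## References
* [Rogawski1990] J. D. Rogawski, *Automorphic Representations of Unitary Groups in Three Variables*, Ann. of Math. Stud. 123 (1990): §4.9 Prop. 4.9.1 (b) p. 55, Lemma 4.9.3 p. 56;
  §4.3 (4.3.1) p. 43.
* [Kottwitz1988] R. E. Kottwitz, *Tamagawa numbers*, Ann. of Math. 127 (1988): §2 (orbital integrals of indicators as fixed-coset counts).
* [LabesseLanglands1979] J.-P. Labesse, R. P. Langlands, *L-indistinguishability for SL(2)*, Canad. J. Math. 31 (1979): §2 Lemma 2.1 p. 8 (fixed balls of elliptic tori).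
* [Tits1979] J. Tits, *Reductive groups over local fields*, PSPM 33.1 (1979): §2.7 p. 48, §3.2 p. 50 (vertex stabilisers of the quasi-split `U(2)` tree; the `ϖ`-modular vertex).
-/

noncomputable section

namespace Summit.HodgeConjecture.HodgeConjecture.Cruxes.H413.F0P3cDyRamHProfilesTypeTwoUnfolding

open MeasureTheory Measure NumberField IsDedekindDomain Topology Filter MulAction
open Literature.NumberTheory.Automorphic Literature.NumberTheory.Automorphic.UnitaryGroup Literature.NumberTheory.Automorphic.IntegralReduction
open Literature.NumberTheory.Rogawski1990 Literature.NumberTheory.GaloisRepresentations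
open Summit.HodgeConjecture.HodgeConjecture.Cruxes.H413.F0P3cDyRamFourFrameHFamilyDefs
open scoped Matrix MatrixGroups

section Place

variable (L : Type) [Field L] [NumberField L] [IsCMField L] {v : HeightOneSpectrum (𝓞 ↥(maximalRealSubfield L))}
  (w : UnitaryGroup.PlacesOver L v) (hw : IsCMField.complexConj L • w.1 = w.1)

/-! ## §1  The two profiles as indicators of `C × U₁` -/

include hw in
/-- **`1_{K_H} = 1_{K₂ × U₁}`**: at a non-split place the rank-one factor `U(Φ₁)(L⁺_v)` is its own integral level (★ `cmLocalIntegralLevel_one_eq_top_of_smul_eq`), so the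
integral level `K_H = K₂ × K₁` of `H_v` is `K₂ × ⊤`. [cite: Rogawski1990, §4.9 Prop. 4.9.1 (b) p. 55] -/
theorem hProfileZero_eq_indicator_prod_top :
    hProfileZero L v = Set.indicator
      (((cmLocalIntegralLevel L 2 (Matrix.of fun i j : Fin 2 => if i.val + j.val + 1 = 2 then (1 : L) else 0) v).prod
          (⊤ : Subgroup ((cmDatum L 1 (Matrix.of fun i j : Fin 1 => if i.val + j.val + 1 = 1 then (1 : L) else 0)).Local v)) :
          Subgroup ((cmDatum L 2 (Matrix.of fun i j : Fin 2 => if i.val + j.val + 1 = 2 then (1 : L) else 0)).Local v ×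
            (cmDatum L 1 (Matrix.of fun i j : Fin 1 => if i.val + j.val + 1 = 1 then (1 : L) else 0)).Local v)) :
        Set ((cmDatum L 2 (Matrix.of fun i j : Fin 2 => if i.val + j.val + 1 = 2 then (1 : L) else 0)).Local v ×
          (cmDatum L 1 (Matrix.of fun i j : Fin 1 => if i.val + j.val + 1 = 1 then (1 : L) else 0)).Local v))
      (fun _ => (1 : ℂ)) := by
  have hK1 : cmLocalIntegralLevel L 1 (Matrix.of fun i j : Fin 1 => if i.val + j.val + 1 = 1 then (1 : L) else 0) v = ⊤ :=
    cmLocalIntegralLevel_one_eq_top_of_smul_eq L _ w hw (isUnit_placeForm_antidiagOne (E := L) 1 w.1)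
  rw [hProfileZero, hK1]

/-- `hFamily … 0 = hProfileZero` (the `Fin 2` bookkeeping of ★ DEFS LEAF №5). [cite: Rogawski1990, §4.9 Prop. 4.9.1 (b) p. 55] -/
theorem hFamily_zero (ϖ : w.1.adicCompletion L) : hFamily L w hw ϖ 0 = hProfileZero L v := rfl

/-- `hFamily … 1 = hProfileSharp … ϖ` (the `Fin 2` bookkeeping of ★ DEFS LEAF №5). [cite: Rogawski1990, §4.9 Lemma 4.9.3 p. 56] -/
theorem hFamily_one (ϖ : w.1.adicCompletion L) : hFamily L w hw ϖ 1 = hProfileSharp L w hw ϖ := rfl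

/-! ## §2  The type-(2) unfolding of the two profiles at ANY ramified non-split place -/

variable [MeasurableSpace ((cmDatum L 2 (Matrix.of fun i j : Fin 2 => if i.val + j.val + 1 = 2 then (1 : L) else 0)).Local v × (cmDatum L 1 (Matrix.of fun i j : Fin 1 => if i.val + j.val + 1 = 1 then (1 : L) else 0)).Local v)]
  [BorelSpace ((cmDatum L 2 (Matrix.of fun i j : Fin 2 => if i.val + j.val + 1 = 2 then (1 : L) else 0)).Local v × (cmDatum L 1 (Matrix.of fun i j : Fin 1 => if i.val + j.val + 1 = 1 then (1 : L) else 0)).Local v)]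
  [∀ a : ((cmDatum L 2 (Matrix.of fun i j : Fin 2 => if i.val + j.val + 1 = 2 then (1 : L) else 0)).Local v × (cmDatum L 1 (Matrix.of fun i j : Fin 1 => if i.val + j.val + 1 = 1 then (1 : L) else 0)).Local v), MeasurableSpace (((cmDatum L 2 (Matrix.of fun i j : Fin 2 => if i.val + j.val + 1 = 2 then (1 : L) else 0)).Local v × (cmDatum L 1 (Matrix.of fun i j : Fin 1 => if i.val + j.val + 1 = 1 then (1 : L) else 0)).Local v) ⧸ Subgroup.centralizer ({a} : Set ((cmDatum L 2 (Matrix.of fun i j : Fin 2 => if i.val + j.val + 1 = 2 then (1 : L) else 0)).Local v × (cmDatum L 1 (Matrix.of fun i j : Fin 1 => if i.val + j.val + 1 = 1 then (1 : L) else 0)).Local v)))]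
  [∀ a : ((cmDatum L 2 (Matrix.of fun i j : Fin 2 => if i.val + j.val + 1 = 2 then (1 : L) else 0)).Local v × (cmDatum L 1 (Matrix.of fun i j : Fin 1 => if i.val + j.val + 1 = 1 then (1 : L) else 0)).Local v), BorelSpace (((cmDatum L 2 (Matrix.of fun i j : Fin 2 => if i.val + j.val + 1 = 2 then (1 : L) else 0)).Local v × (cmDatum L 1 (Matrix.of fun i j : Fin 1 => if i.val + j.val + 1 = 1 then (1 : L) else 0)).Local v) ⧸ Subgroup.centralizer ({a} : Set ((cmDatum L 2 (Matrix.of fun i j : Fin 2 => if i.val + j.val + 1 = 2 then (1 : L) else 0)).Local v × (cmDatum L 1 (Matrix.of fun i j : Fin 1 => if i.val + j.val + 1 = 1 then (1 : L) else 0)).Local v)))]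
  (νH : Measure ((cmDatum L 2 (Matrix.of fun i j : Fin 2 => if i.val + j.val + 1 = 2 then (1 : L) else 0)).Local v × (cmDatum L 1 (Matrix.of fun i j : Fin 1 => if i.val + j.val + 1 = 1 then (1 : L) else 0)).Local v)) [νH.IsHaarMeasure] [νH.IsMulRightInvariant]

include hw in
/-- **THE PROFILE `s = 0` (`1_{K_H}`) ON THE TYPE-(2) POPULATION, ANY RAMIFIED NON-SPLIT PLACE**: for the canonical family `mH` and a `G`-regular `γ_H = (γ₂, γ₁)` whose
characteristic polynomial at `w` has no root in `L_w`, `Φ^st(γ_H, hFamily … 0) = ν_H(K₂ × U₁) · #Fix_{γ₂}(U₂ ⧸ K₂)`, `K₂ = U(Φ₂)(𝒪_v)` the integral level (★ place-generic unfolding at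
`C := K₂`, compact open ★ `isCompact_isOpen_cmLocalIntegralLevel`; §1).  No tameness hypothesis. [cite: Rogawski1990, §4.9 Prop. 4.9.1 (b) p. 55; §4.3 (4.3.1) p. 43]
[cite: Kottwitz1988, §2] -/
theorem stableOrbitalIntegralRel_hFamily_zero_typeTwo (ϖ : w.1.adicCompletion L)
    {mH : OrbitalMeasureFamily ((cmDatum L 2 (Matrix.of fun i j : Fin 2 => if i.val + j.val + 1 = 2 then (1 : L) else 0)).Local v × (cmDatum L 1 (Matrix.of fun i j : Fin 1 => if i.val + j.val + 1 = 1 then (1 : L) else 0)).Local v)} (hmH : mH.IsCanonical (IsLocalGRegular L v) νH)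
    {γH : ((cmDatum L 2 (Matrix.of fun i j : Fin 2 => if i.val + j.val + 1 = 2 then (1 : L) else 0)).Local v × (cmDatum L 1 (Matrix.of fun i j : Fin 1 => if i.val + j.val + 1 = 1 then (1 : L) else 0)).Local v)} (hreg : IsLocalGRegular L v γH)
    (hirr : ¬ ∃ x : (w.1.adicCompletion L), ((((γH.1.val : GL (Fin 2) (UnitaryGroup.LocalRing L v)).val.map (Pi.evalRingHom (fun w' : PlacesOver L v => w'.1.adicCompletion L) w))).charpoly).IsRoot x) :
    stableOrbitalIntegralRel (IsLocalStablyConjH L v) mH (hFamily L w hw ϖ 0) γH =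
      (νH.real (((cmLocalIntegralLevel L 2 (Matrix.of fun i j : Fin 2 => if i.val + j.val + 1 = 2 then (1 : L) else 0) v).prod (⊤ : Subgroup ((cmDatum L 1 (Matrix.of fun i j : Fin 1 => if i.val + j.val + 1 = 1 then (1 : L) else 0)).Local v)) : Subgroup ((cmDatum L 2 (Matrix.of fun i j : Fin 2 => if i.val + j.val + 1 = 2 then (1 : L) else 0)).Local v × (cmDatum L 1 (Matrix.of fun i j : Fin 1 => if i.val + j.val + 1 = 1 then (1 : L) else 0)).Local v)) : Set ((cmDatum L 2 (Matrix.of fun i j : Fin 2 => if i.val + j.val + 1 = 2 then (1 : L) else 0)).Local v × (cmDatum L 1 (Matrix.of fun i j : Fin 1 => if i.val + j.val + 1 = 1 then (1 : L) else 0)).Local v)) : ℂ) *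
        (Nat.card (fixedBy (((cmDatum L 2 (Matrix.of fun i j : Fin 2 => if i.val + j.val + 1 = 2 then (1 : L) else 0)).Local v) ⧸ cmLocalIntegralLevel L 2 (Matrix.of fun i j : Fin 2 => if i.val + j.val + 1 = 2 then (1 : L) else 0) v) γH.1) : ℂ) := by
  rw [hFamily_zero, hProfileZero_eq_indicator_prod_top L w hw]
  have hK := isCompact_isOpen_cmLocalIntegralLevel L 2 (Matrix.of fun i j : Fin 2 => if i.val + j.val + 1 = 2 then (1 : L) else 0) v
  exact stableOrbitalIntegralRel_indicator_prod_top_eq_mul_natCard_fixedBy_of_not_exists_isRoot L v w hw νH hmH _ hK.2 hK.1 hreg hirr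

include hw in
/-- **THE PROFILE `s = 1` (`1_{K♯ × U₁}`) ON THE TYPE-(2) POPULATION, ANY RAMIFIED NON-SPLIT PLACE**: for a uniformiser `ϖ` (as a unit), there is a compact open subgroup
`K♯ ≤ U(Φ₂)(L⁺_v)` — the stabiliser of the `ϖ`-modular vertex, `g ∈ K♯ ↔ ψ(g) ∈ D_ϖ GL₂(𝒪_w) D_ϖ⁻¹` (★ `exists_vertexCover_of_ramified_wild`, no tameness) — such that for the
canonical family `mH` and every `G`-regular type-(2) `γ_H`: `Φ^st(γ_H, hFamily … 1) = ν_H(K♯ × U₁) · #Fix_{γ₂}(U₂ ⧸ K♯)` (★ the `χ♯` column, whose set-builder is `hProfileSharp`'s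
verbatim). [cite: Rogawski1990, §4.9 Lemma 4.9.3 p. 56, Prop. 4.9.1 (b) p. 55] [cite: Tits1979, §3.2 p. 50] [cite: Kottwitz1988, §2] -/
theorem exists_stableOrbitalIntegralRel_hFamily_one_typeTwo (he : v.asIdeal.ramificationIdx' w.1.asIdeal ≠ 1)
    (ϖ : (w.1.adicCompletion L)ˣ) (hϖ : Valued.v (ϖ : w.1.adicCompletion L) = WithZero.exp (-1 : ℤ))
    {mH : OrbitalMeasureFamily ((cmDatum L 2 (Matrix.of fun i j : Fin 2 => if i.val + j.val + 1 = 2 then (1 : L) else 0)).Local v × (cmDatum L 1 (Matrix.of fun i j : Fin 1 => if i.val + j.val + 1 = 1 then (1 : L) else 0)).Local v)} (hmH : mH.IsCanonical (IsLocalGRegular L v) νH) :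
    ∃ Ksh : Subgroup ((cmDatum L 2 (Matrix.of fun i j : Fin 2 => if i.val + j.val + 1 = 2 then (1 : L) else 0)).Local v),
      (∀ g, g ∈ Ksh ↔
        (((localNonsplitEquiv (IsCMField.complexConj L) (Matrix.of fun i j : Fin 2 => if i.val + j.val + 1 = 2 then (1 : L) else 0) (IsCMField.complexConj_ne_one L) w hw) g : ↥(unitaryGroupOfForm (galAdicCompletionMap (L := L) (IsCMField.complexConj L) hw) (placeForm (Matrix.of fun i j : Fin 2 => if i.val + j.val + 1 = 2 then (1 : L) else 0) w.1))) : GL (Fin 2) (w.1.adicCompletion L)) ∈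
          (glInt 2 (w.1.adicCompletion L)).map (MulAut.conj (glDiagonal 2 (w.1.adicCompletion L) ![1, ϖ])).toMonoidHom) ∧
      IsOpen (Ksh : Set ((cmDatum L 2 (Matrix.of fun i j : Fin 2 => if i.val + j.val + 1 = 2 then (1 : L) else 0)).Local v)) ∧
      IsCompact (Ksh : Set ((cmDatum L 2 (Matrix.of fun i j : Fin 2 => if i.val + j.val + 1 = 2 then (1 : L) else 0)).Local v)) ∧
      ∀ {γH : ((cmDatum L 2 (Matrix.of fun i j : Fin 2 => if i.val + j.val + 1 = 2 then (1 : L) else 0)).Local v × (cmDatum L 1 (Matrix.of fun i j : Fin 1 => if i.val + j.val + 1 = 1 then (1 : L) else 0)).Local v)},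
        IsLocalGRegular L v γH →
        (¬ ∃ x : (w.1.adicCompletion L), ((((γH.1.val : GL (Fin 2) (UnitaryGroup.LocalRing L v)).val.map (Pi.evalRingHom (fun w' : PlacesOver L v => w'.1.adicCompletion L) w))).charpoly).IsRoot x) →
        stableOrbitalIntegralRel (IsLocalStablyConjH L v) mH (hFamily L w hw (ϖ : w.1.adicCompletion L) 1) γH =
          (νH.real ((Ksh.prod (⊤ : Subgroup ((cmDatum L 1 (Matrix.of fun i j : Fin 1 => if i.val + j.val + 1 = 1 then (1 : L) else 0)).Local v)) : Subgroup ((cmDatum L 2 (Matrix.of fun i j : Fin 2 => if i.val + j.val + 1 = 2 then (1 : L) else 0)).Local v × (cmDatum L 1 (Matrix.of fun i j : Fin 1 => if i.val + j.val + 1 = 1 then (1 : L) else 0)).Local v)) : Set ((cmDatum L 2 (Matrix.of fun i j : Fin 2 => if i.val + j.val + 1 = 2 then (1 : L) else 0)).Local v × (cmDatum L 1 (Matrix.of fun i j : Fin 1 => if i.val + j.val + 1 = 1 then (1 : L) else 0)).Local v)) : ℂ) *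
            (Nat.card (fixedBy (((cmDatum L 2 (Matrix.of fun i j : Fin 2 => if i.val + j.val + 1 = 2 then (1 : L) else 0)).Local v) ⧸ Ksh) γH.1) : ℂ) := by
  obtain ⟨K₂, -, -, hK1mem, hKo, hKc, -⟩ := exists_vertexCover_of_ramified_wild L v w hw he ϖ hϖ
  refine ⟨K₂ 1, hK1mem, hKo 1, hKc 1, fun {γH} hreg hirr => ?_⟩
  rw [hFamily_one]
  exact stableOrbitalIntegralRel_indicator_sharp_eq_mul_natCard_fixedBy_of_not_exists_isRoot L v w hw νH hmH ϖ (K₂ 1) hK1mem (hKo 1) (hKc 1) hreg hirr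

end Place

end Summit.HodgeConjecture.HodgeConjecture.Cruxes.H413.F0P3cDyRamHProfilesTypeTwoUnfolding

end
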